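import Mathlib
import Summits.ResolutionOfSingularities.ResolutionOfSingularities.Theorems.WildQuotientsWildQuotientResolutionJordanFourParity
import Summits.ResolutionOfSingularities.ResolutionOfSingularities.Theorems.WildQuotientsWildQuotientResolutionHalf111Defs
import HarnessLib

/-!
# V4U piece B0-b½ — the μ₂ PRESENTATION TRANSPORT: the Artin–Schreier slot substitution `S_N` carries the even subalgebra
# `E = adjoin k (evenGens)` isomorphically onto stub-1's fixed ∩ even ring, and `E` is the range of the `½(1,1,1)` presentation

(crux stmt-ResolutionOfSingularities-15640 `WildQuotients.WildQuotientResolution`, line `Sketch`, sector `|G| = p`; programme V4U of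
`L/w45c/CHAIN.md` v7.2, res-L1-w45c-plan-1 ORDER B0-b½ 2026-08-27T05:41:48Z to res-type-087, statements copied from the farm-checked SIG file
`L/res-L1-w45c-plan-1/sig/B0bHalfSig.lean`. [OURS · L1 W4.5c] — NOT a statement of any manuscript; replaces the role of no printed item.
Prover res-type-087.)

Slots `s = X b`, `A = X a`, `ξ = X c`; `N = ξ^p − s^{p−1} ξ` (the Artin–Schreier norm form in the slot `c`).
* `substN k n b c p` — the `k`-algebra endomorphism `S_N` of `k[X]`: `X c ↦ N`, `X i ↦ X i` (`i ≠ c`).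
* `substN_injective` — `S_N` is injective for `b ≠ c`, `p ≥ 2`: after `k[X] ≅ (k[X_{i≠c}])[T]` (`T = X c`; Mathlib `optionEquivLeft` along
  `Equiv.optionSubtypeNe c`) it is composition with the polynomial `T^p − s^{p−1} T` of degree `p ≥ 2`, and `P ∘ q = 0 ⇒ P = 0` over a domain
  (`Polynomial.comp_eq_zero_iff`).
* `map_substN_adjoin_evenGens` — `S_N(E) = adjoin k ({s², sA, sN, A², AN, N²} ∪ passengers)` (the literal of stub-1's p501651
  `translate_fixedPoints_inter_even_eq`), by `AlgHom.map_adjoin` and the images of the generators.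
* `range_halfPresentation_eq_adjoin_evenGens` — `(Half111.presentation k n a b c).range = E` (no distinctness hypotheses needed).
* `halfTransportEquiv` — the packaged `k`-algebra isomorphism `↥(Half111.presentation …).range ≃ₐ[k] ↥(adjoin k ({…N…} ∪ passengers))`
  (`equivOfEq ∘ equivMapOfInjective ∘ equivOfEq`, as in the SIG file) with its value lemma `coe_halfTransportEquiv` (`= S_N` on elements).
CONSUMER: res-L1-w45c-stub-3 (HP₁). AI proving weaker than expert review; no claim beyond the kernel.
-/

-- single-problem summit: the doubled namespace component `ResolutionOfSingularities` is forced
set_option linter.dupNamespace false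

noncomputable section

open MvPolynomial

namespace Summit.ResolutionOfSingularities.ResolutionOfSingularities.Theorems.WildQuotientResolution.JordanFour

variable (k : Type) [Field k] (n : ℕ) (a b c : Fin n) (p : ℕ)

/-- The Artin–Schreier slot substitution `S_N : X c ↦ N = X c ^ p − X b ^ (p−1) X c`, `X i ↦ X i` (`i ≠ c`), as a `k`-algebra endomorphism of
`k[X₀,…,X_{n−1}]`. [OURS · L1 W4.5c] -/
noncomputable def substN : MvPolynomial (Fin n) k →ₐ[k] MvPolynomial (Fin n) k :=
  MvPolynomial.aeval (fun i => if i = c then X c ^ p - X b ^ (p - 1) * X c else X i)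

/-- `S_N` on a variable. [folklore] -/
theorem substN_X (i : Fin n) :
    substN k n b c p (X i) = if i = c then X c ^ p - X b ^ (p - 1) * X c else X i := by
  simp [substN]

/-- `S_N (X c) = N`. [folklore] -/
@[simp] theorem substN_X_self : substN k n b c p (X c) = X c ^ p - X b ^ (p - 1) * X c := by
  rw [substN_X, if_pos rfl]

/-- `S_N (X i) = X i` for `i ≠ c`. [folklore] -/
@[simp] theorem substN_X_of_ne {i : Fin n} (hi : i ≠ c) : substN k n b c p (X i) = X i := by
  rw [substN_X, if_neg hi]

/-! ## Injectivity of `S_N` -/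

/-- **`S_N` is injective** (`b ≠ c`, `p ≥ 2`): identify `k[X] ≅ (k[X_{i≠c}])[T]`, `T = X c`; then `S_N` becomes `P ↦ P(T^p − s^{p−1}T)`,
and composition with a polynomial of degree `p ≥ 2` over the domain `k[X_{i≠c}]` kills only `0`. [folklore] -/
theorem substN_injective (hbc : b ≠ c) (hp : 2 ≤ p) : Function.Injective (substN k n b c p) := by
  classical
  -- `k[X] ≅ A[T]`, `A = k[X_{i ≠ c}]`, `T ↔ X c`
  let e : Option {i : Fin n // i ≠ c} ≃ Fin n := Equiv.optionSubtypeNe c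
  let Φ : MvPolynomial (Fin n) k ≃ₐ[k] Polynomial (MvPolynomial {i : Fin n // i ≠ c} k) :=
    (MvPolynomial.renameEquiv k e.symm).trans (MvPolynomial.optionEquivLeft k {i : Fin n // i ≠ c})
  have hΦX : ∀ i : Fin n, Φ (X i) = optionEquivLeft k {i : Fin n // i ≠ c} (X (e.symm i)) := by
    intro i
    change optionEquivLeft k _ (rename e.symm (X i)) = _
    rw [rename_X]
  have hΦc : Φ (X c) = Polynomial.X := by
    rw [hΦX, show e.symm c = none from Equiv.optionSubtypeNe_symm_self c, optionEquivLeft_X_none]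
  have hΦi : ∀ (i : Fin n) (hi : i ≠ c), Φ (X i) = Polynomial.C (X ⟨i, hi⟩) := by
    intro i hi
    rw [hΦX, show e.symm i = some ⟨i, hi⟩ from Equiv.optionSubtypeNe_symm_of_ne hi, optionEquivLeft_X_some]
  -- the polynomial `q = T^p − s^{p−1} T`
  set q : Polynomial (MvPolynomial {i : Fin n // i ≠ c} k) :=
    Polynomial.X ^ p - Polynomial.C (X ⟨b, hbc⟩) ^ (p - 1) * Polynomial.X with hq
  -- `Φ ∘ S_N = (aeval q) ∘ Φ`
  have hcomm : Φ.toAlgHom.comp (substN k n b c p) =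
      ((Polynomial.aeval q).restrictScalars k).comp Φ.toAlgHom := by
    apply MvPolynomial.algHom_ext
    intro i
    change Φ (substN k n b c p (X i)) = Polynomial.aeval q (Φ (X i))
    by_cases hi : i = c
    · rw [hi, substN_X_self, map_sub, map_pow, map_mul, map_pow, hΦc, hΦi b hbc, Polynomial.aeval_X]
    · rw [substN_X_of_ne k n b c p hi, hΦi i hi, Polynomial.aeval_C, Polynomial.algebraMap_eq]
  have hcomm' : ∀ f, Φ (substN k n b c p f) = Polynomial.aeval q (Φ f) := fun f => by
    have := AlgHom.congr_fun hcomm f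
    simpa using this
  -- `q` has degree `p ≥ 2`
  have hqdeg : q.natDegree = p := by
    rw [hq, Polynomial.natDegree_sub_eq_left_of_natDegree_lt] <;> rw [Polynomial.natDegree_X_pow]
    calc (Polynomial.C (X ⟨b, hbc⟩ : MvPolynomial {i : Fin n // i ≠ c} k) ^ (p - 1) * Polynomial.X).natDegree
        ≤ (Polynomial.C (X ⟨b, hbc⟩ : MvPolynomial {i : Fin n // i ≠ c} k) ^ (p - 1)).natDegree +
            (Polynomial.X : Polynomial (MvPolynomial {i : Fin n // i ≠ c} k)).natDegree := Polynomial.natDegree_mul_le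
      _ ≤ 0 + 1 := by
          gcongr
          · rw [← map_pow, Polynomial.natDegree_C]
          · exact Polynomial.natDegree_X_le
      _ < p := by omega
  -- conclude
  refine (injective_iff_map_eq_zero _).2 fun f hf => ?_
  have h1 : Polynomial.aeval q (Φ f) = 0 := by rw [← hcomm', hf, map_zero]
  rw [← Polynomial.comp_eq_aeval, Polynomial.comp_eq_zero_iff] at h1
  rcases h1 with h1 | ⟨-, h2⟩
  · exact Φ.injective (by rw [h1, map_zero])
  · have : q.natDegree = 0 := by rw [h2, Polynomial.natDegree_C]
    omega

/-! ## The image of the even subalgebra under `S_N` -/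

/-- **`S_N` carries the even subalgebra onto stub-1's fixed ∩ even ring** (the literal right-hand side of p501651
`translate_fixedPoints_inter_even_eq`): `S_N(adjoin k (evenGens)) = adjoin k ({s², sA, sN, A², AN, N²} ∪ {X i : i ∉ {a,b,c}})`,
`N = X c ^ p − X b ^ (p−1) X c`. By `AlgHom.map_adjoin` and the images of the generators (`a, b, c` distinct). [OURS · L1 W4.5c] -/
theorem map_substN_adjoin_evenGens (_hab : a ≠ b) (hac : a ≠ c) (hbc : b ≠ c) :
    Subalgebra.map (substN k n b c p) (Algebra.adjoin k (evenGens k n a b c)) =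
      Algebra.adjoin k (({X b ^ 2, X b * X a, X b * (X c ^ p - X b ^ (p - 1) * X c), X a ^ 2,
          X a * (X c ^ p - X b ^ (p - 1) * X c), (X c ^ p - X b ^ (p - 1) * X c) ^ 2} :
          Set (MvPolynomial (Fin n) k)) ∪ ((fun i => X i) '' {i | i ≠ a ∧ i ≠ b ∧ i ≠ c})) := by
  rw [AlgHom.map_adjoin]
  congr 1
  have hpass : (substN k n b c p : MvPolynomial (Fin n) k → MvPolynomial (Fin n) k) '' ((fun i => X i) '' {i | i ≠ a ∧ i ≠ b ∧ i ≠ c}) =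
      (fun i => X i) '' {i | i ≠ a ∧ i ≠ b ∧ i ≠ c} := by
    rw [Set.image_image]
    exact Set.image_congr fun i hi => substN_X_of_ne k n b c p hi.2.2
  rw [evenGens, Set.image_union, hpass]
  congr 1
  simp only [Set.image_insert_eq, Set.image_singleton, map_pow, map_mul, substN_X_self, substN_X_of_ne k n b c p hac,
    substN_X_of_ne k n b c p hbc]
  rw [mul_comm (X b : MvPolynomial (Fin n) k) (X a)]
  ext x
  simp only [Set.mem_insert_iff, Set.mem_singleton_iff]
  tauto

/-! ## The range of the `½(1,1,1)` presentation -/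

/-- **The half-cone presentation has range the even subalgebra**: `(Half111.presentation k n a b c).range = adjoin k (evenGens k n a b c)`.
The presentation's variable images are `X a², X b², X c², X i (i ∉ {a,b,c}), X a X b, X a X c, X b X c` — exactly the generators of record
of `E` (no distinctness of `a, b, c` is needed: for coincident indices both sides degenerate compatibly). [OURS · L1 W4.5c] -/
theorem range_halfPresentation_eq_adjoin_evenGens :
    (Half111.presentation k n a b c).range = Algebra.adjoin k (evenGens k n a b c) := by
  classical
  apply le_antisymm
  · rw [Half111.presentation, ← Algebra.adjoin_range_eq_range_aeval]
    refine Algebra.adjoin_le ?_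
    rintro _ ⟨y, rfl⟩
    rcases y with i | j
    · simp only [Sum.elim_inl]
      by_cases hia : i = a
      · rw [if_pos hia]; exact Algebra.subset_adjoin (Or.inl (by simp))
      · rw [if_neg hia]
        by_cases hib : i = b
        · rw [if_pos hib]; exact Algebra.subset_adjoin (Or.inl (by simp))
        · rw [if_neg hib]
          by_cases hic : i = c
          · rw [if_pos hic]; exact Algebra.subset_adjoin (Or.inl (by simp))
          · rw [if_neg hic]; exact Algebra.subset_adjoin (Or.inr ⟨i, ⟨hia, hib, hic⟩, rfl⟩)
    · fin_cases j
      · exact Algebra.subset_adjoin (Or.inl (by simp))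
      · exact Algebra.subset_adjoin (Or.inl (by simp))
      · exact Algebra.subset_adjoin (Or.inl (by simp))
  · refine Algebra.adjoin_le ?_
    rintro x (hx | ⟨i, ⟨hia, hib, hic⟩, rfl⟩)
    · simp only [Set.mem_insert_iff, Set.mem_singleton_iff] at hx
      rcases hx with rfl | rfl | rfl | rfl | rfl | rfl
      · exact ⟨X (Sum.inl a), Half111.presentation_inl_a k n a b c⟩
      · exact ⟨X (Sum.inr 0), Half111.presentation_inr_zero k n a b c⟩
      · exact ⟨X (Sum.inr 1), Half111.presentation_inr_one k n a b c⟩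
      · by_cases hab : a = b
        · subst hab; exact ⟨X (Sum.inl a), Half111.presentation_inl_a k n a a c⟩
        · exact ⟨X (Sum.inl b), Half111.presentation_inl_b k n a b c hab⟩
      · exact ⟨X (Sum.inr 2), Half111.presentation_inr_two k n a b c⟩
      · by_cases hac : a = c
        · subst hac; exact ⟨X (Sum.inl a), Half111.presentation_inl_a k n a b a⟩
        · by_cases hbc : b = c
          · subst hbc
            by_cases hab : a = b
            · subst hab; exact ⟨X (Sum.inl a), Half111.presentation_inl_a k n a a a⟩
            · exact ⟨X (Sum.inl b), Half111.presentation_inl_b k n a b b hab⟩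
          · exact ⟨X (Sum.inl c), Half111.presentation_inl_c k n a b c hac hbc⟩
    · exact ⟨X (Sum.inl i), Half111.presentation_inl_of_ne k n a b c i hia hib hic⟩

/-! ## The packaged transport equivalence -/

/-- **The μ₂ presentation transport**: the presented ring of the `½(1,1,1)` cone (as the range of `Half111.presentation`) is `k`-isomorphic,
via `S_N`, to stub-1's fixed ∩ even ring `adjoin k ({s², sA, sN, A², AN, N²} ∪ passengers)`: `equivOfEq` (range = `E`) ≫ `equivMapOfInjective`
(`S_N` injective on `E`) ≫ `equivOfEq` (`S_N(E)` = the target). CONSUMER: res-L1-w45c-stub-3 (HP₁). [OURS · L1 W4.5c] -/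
noncomputable def halfTransportEquiv (hab : a ≠ b) (hac : a ≠ c) (hbc : b ≠ c) (hp : 2 ≤ p) :
    ↥(Half111.presentation k n a b c).range ≃ₐ[k]
      ↥(Algebra.adjoin k (({X b ^ 2, X b * X a, X b * (X c ^ p - X b ^ (p - 1) * X c), X a ^ 2,
          X a * (X c ^ p - X b ^ (p - 1) * X c), (X c ^ p - X b ^ (p - 1) * X c) ^ 2} :
          Set (MvPolynomial (Fin n) k)) ∪ ((fun i => X i) '' {i | i ≠ a ∧ i ≠ b ∧ i ≠ c}))) :=
  (Subalgebra.equivOfEq _ _ (range_halfPresentation_eq_adjoin_evenGens k n a b c)).trans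
    (((Algebra.adjoin k (evenGens k n a b c)).equivMapOfInjective _ (substN_injective k n b c p hbc hp)).trans
      (Subalgebra.equivOfEq _ _ (map_substN_adjoin_evenGens k n a b c p hab hac hbc)))

/-- The transport acts by `S_N` on underlying polynomials. [folklore] -/
@[simp] theorem coe_halfTransportEquiv (hab : a ≠ b) (hac : a ≠ c) (hbc : b ≠ c) (hp : 2 ≤ p)
    (x : ↥(Half111.presentation k n a b c).range) :
    ((halfTransportEquiv k n a b c p hab hac hbc hp x : _) : MvPolynomial (Fin n) k) = substN k n b c p x :=
  rfl

/-- The transport on the six generator images of record and on passengers (values): `s² ↦ s²`, `sA ↦ sA`, `sξ ↦ sN`, `A² ↦ A²`, `Aξ ↦ AN`,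
`ξ² ↦ N²`, `X i ↦ X i`. [folklore] -/
theorem halfTransportEquiv_values (hac : a ≠ c) (hbc : b ≠ c) :
    substN k n b c p (X b ^ 2) = X b ^ 2 ∧ substN k n b c p (X a * X b) = X a * X b ∧
      substN k n b c p (X b * X c) = X b * (X c ^ p - X b ^ (p - 1) * X c) ∧ substN k n b c p (X a ^ 2) = X a ^ 2 ∧
      substN k n b c p (X a * X c) = X a * (X c ^ p - X b ^ (p - 1) * X c) ∧
      substN k n b c p (X c ^ 2) = (X c ^ p - X b ^ (p - 1) * X c) ^ 2 ∧
      ∀ i : Fin n, i ≠ c → substN k n b c p (X i) = X i := by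
  refine ⟨?_, ?_, ?_, ?_, ?_, ?_, fun i hi => substN_X_of_ne k n b c p hi⟩ <;>
    simp [map_pow, map_mul, substN_X_of_ne k n b c p hac, substN_X_of_ne k n b c p hbc]

end Summit.ResolutionOfSingularities.ResolutionOfSingularities.Theorems.WildQuotientResolution.JordanFour

end
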